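import Summits.QuantumFields.YangMills.Theorems.LuscherReductionTwistedTraceScalingTowerAWilson4D
import HarnessLib

/-!
# Crux `TwistedTraceScaling` (stmt-QuantumFields-20203), LEAD-KIT §3 A2 — the 4D dictionary, JOINT FORM: `wilson4D` as ONE integral over all link
# variables of `(ℤ/L)³ × (ℤ/(n+1))` (spatial and temporal links jointly, product of the Haar product measures)

Support module of the `FemtoTransferGap` group (fleet service by seat ym-infvol-p2 g7; route `LuscherReduction`, owner ym-beyond-p1, femto rung R2b1).
Companion of `Theorems/LuscherReductionTwistedTraceScalingTowerAWilson4D.lean` (`TowerA.wilson4D`, `TowerA.physTrace_eq_twistAvg_wilson4D`), where the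
all-links integral is written in iterated form `∫ dUs (∫ dgs …)`.  For a renormalisation-group consumer that integrates over ALL links of the 4D torus at
once, this file rewrites it as a single Bochner integral over `(Fin (n+1) → GaugeConfig 3 L SU2) × (Fin (n+1) → (Site 3 L → SU2))` against the product
measure `(⊗ configMeasure) ⊗ (⊗ gaugeMeasure)` (Fubini for the bounded, jointly measurable weight): `wilson4D_eq_integral_prod`, with the weight's joint
measurability `measurable_wilsonWeight` (made syntactic by `simp only [Function.comp_def, Function.uncurry_apply_pair]`) and bound `abs_wilsonWeight_le`.

HONEST FRAMING: a fixed-lattice identity (Fubini), no estimate, no renormalisation-group content; femto rung R2b1 only; nothing here bears on infinite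
volume, the continuum limit in large volume, or the Clay mass gap.  References: [cite: MontvayMunster1994, (3.145)]; [cite: SeilerLNP1982, §3].
-/

set_option autoImplicit false

noncomputable section

namespace Summit.QuantumFields.YangMills.Theorems.FemtoTransferGap.TowerA

open MeasureTheory
open Literature.MathematicalPhysics.QuantumFieldTheory
open Literature.MathematicalPhysics.QuantumLattice
open Literature.Analysis.OperatorTheory.YMMatrixModel
open Summit.QuantumFields.YangMills.Theorems.FemtoTransferGap
open Summit.QuantumFields.YangMills.Theorems.FemtoTransferGap.TT
open Summit.QuantumFields.YangMills.Theorems.FemtoTransferGap.PhysL2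

variable {L : ℕ} [NeZero L]

/-! ## §4 The all-links integral as ONE integral over the product of all link variables (Fubini) -/

/-- Joint measurability of the all-links weight `(Us, gs) ↦ ∏_t K_β(Us t, gs t · tw^{(t)} Us (t+1))`. [folklore] -/
theorem measurable_wilsonWeight (β : ℝ) (z : Fin 3 → Bool) (n : ℕ) :
    Measurable fun p : (Fin (n + 1) → GaugeConfig 3 L SU2) × (Fin (n + 1) → (Site 3 L → SU2)) =>
      ∏ i : Fin (n + 1), transferKernel su2Rep β (p.1 i)
        (gaugeTransform (p.2 i) (twist3 (if i = Fin.last n then z else fun _ => false) (p.1 (i + 1)))) := by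
  refine Finset.measurable_prod _ fun i _ => ?_
  have hK := (stronglyMeasurable_transferKernel (L := L) β).measurable
  have h1 : Measurable fun p : (Fin (n + 1) → GaugeConfig 3 L SU2) × (Fin (n + 1) → (Site 3 L → SU2)) => p.1 i :=
    (measurable_pi_apply (X := fun _ : Fin (n + 1) => GaugeConfig 3 L SU2) i).comp measurable_fst
  have h2 : Measurable fun p : (Fin (n + 1) → GaugeConfig 3 L SU2) × (Fin (n + 1) → (Site 3 L → SU2)) =>
      (p.2 i, p.1 (i + 1)) :=
    ((measurable_pi_apply (X := fun _ : Fin (n + 1) => Site 3 L → SU2) i).comp measurable_snd).prodMk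
      ((measurable_pi_apply (X := fun _ : Fin (n + 1) => GaugeConfig 3 L SU2) (i + 1)).comp measurable_fst)
  have h3 := (measurable_act_uncurry (L := L) (if i = Fin.last n then z else fun _ => false)).comp h2
  have h4 := hK.comp (h1.prodMk h3)
  simpa only [Function.comp_def, Function.uncurry_apply_pair] using h4

/-- Bound of the all-links weight: `|∏_t K_β(…)| ≤ M^{n+1}`. [folklore] -/
theorem abs_wilsonWeight_le {β M : ℝ} (hM : ∀ U V : GaugeConfig 3 L SU2, |transferKernel su2Rep β U V| ≤ M) (z : Fin 3 → Bool) (n : ℕ)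
    (p : (Fin (n + 1) → GaugeConfig 3 L SU2) × (Fin (n + 1) → (Site 3 L → SU2))) :
    |∏ i : Fin (n + 1), transferKernel su2Rep β (p.1 i)
        (gaugeTransform (p.2 i) (twist3 (if i = Fin.last n then z else fun _ => false) (p.1 (i + 1))))| ≤ M ^ (n + 1) := by
  rw [Finset.abs_prod]
  calc ∏ i : Fin (n + 1), |transferKernel su2Rep β (p.1 i)
          (gaugeTransform (p.2 i) (twist3 (if i = Fin.last n then z else fun _ => false) (p.1 (i + 1))))|
      ≤ ∏ _i : Fin (n + 1), M := Finset.prod_le_prod (fun i _ => abs_nonneg _) fun i _ => hM _ _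
    _ = M ^ (n + 1) := by simp

/-- ★ **`wilson4D` as ONE integral over all link variables** of `(ℤ/L)³ × (ℤ/(n+1))` — spatial links `Us` and temporal links `gs` jointly, against the
product of the a-priori Haar product measures (Fubini for the bounded measurable weight). [cite: MontvayMunster1994, (3.145)] -/
theorem wilson4D_eq_integral_prod (β : ℝ) (z : Fin 3 → Bool) (n : ℕ) :
    wilson4D L β z n =
      ∫ p : (Fin (n + 1) → GaugeConfig 3 L SU2) × (Fin (n + 1) → (Site 3 L → SU2)),
        ∏ i : Fin (n + 1), transferKernel su2Rep β (p.1 i)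
          (gaugeTransform (p.2 i) (twist3 (if i = Fin.last n then z else fun _ => false) (p.1 (i + 1))))
        ∂((Measure.pi fun _ : Fin (n + 1) => configMeasure SU2 L).prod (Measure.pi fun _ : Fin (n + 1) => gaugeMeasure L)) := by
  haveI := isProbabilityMeasure_gaugeMeasure (L := L)
  obtain ⟨M, hM0, hM⟩ := exists_abs_transferKernel_le (L := L) β
  have hint : Integrable (fun p : (Fin (n + 1) → GaugeConfig 3 L SU2) × (Fin (n + 1) → (Site 3 L → SU2)) =>
      ∏ i : Fin (n + 1), transferKernel su2Rep β (p.1 i)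
        (gaugeTransform (p.2 i) (twist3 (if i = Fin.last n then z else fun _ => false) (p.1 (i + 1)))))
      ((Measure.pi fun _ : Fin (n + 1) => configMeasure SU2 L).prod (Measure.pi fun _ : Fin (n + 1) => gaugeMeasure L)) := by
    refine Integrable.of_bound (measurable_wilsonWeight β z n).aestronglyMeasurable (M ^ (n + 1)) (ae_of_all _ fun p => ?_)
    rw [Real.norm_eq_abs]
    exact abs_wilsonWeight_le hM z n p
  unfold wilson4D
  rw [integral_prod _ hint]

end Summit.QuantumFields.YangMills.Theorems.FemtoTransferGap.TowerA

end
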